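import Summits.HodgeConjecture.HodgeConjecture.Theses.HCCMUnconditional
import Summits.HodgeConjecture.HodgeConjecture.Theorems.HCCMUnconditionalH411
import Summits.HodgeConjecture.HodgeConjecture.Theorems.HCCMUnconditionalHD1pp
import Summits.HodgeConjecture.CorCM.HypLiu418.A3Liu418FaceTypes
import Summits.HodgeConjecture.CorCM.HypLiu418.A3Liu418EtaleItems
import Summits.HodgeConjecture.CorCM.HypLiu418.A3Liu418Items
import Summits.HodgeConjecture.CorCM.HypLiu418.A3Liu418AlbTransitionEpi
import Summits.HodgeConjecture.CorCM.HypLiu418.A3Liu418HonestIsogenyDescent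
import Summits.HodgeConjecture.CorCM.HypLiu418.A3Liu418LabelSeparation
import Summits.HodgeConjecture.CorCM.HypLiu418.A3Liu418NonIso
import Summits.HodgeConjecture.CorCM.HypLiu418.A3Liu418BettiThetaModelAtPlace
import Summits.HodgeConjecture.CorCM.HypLiu418.A3Liu418BettiThetaModelOffPlace
import Summits.HodgeConjecture.CorCM.HypLiu418.A3Liu418PinBettiPinningAtPin
import Summits.HodgeConjecture.CorCM.HypLiu418.A3Liu418MainGaloisGlue
import Literature.NumberTheory.Automorphic.Liu2021.AppendixC.EtaleFaltingsIsotypic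
import Literature.AlgebraicGeometry.ShimuraVarieties.UnitaryShimuraCanonicalModelUniqueProofs
import Summits.HodgeConjecture.HodgeConjecture.Theorems.A3Liu418EtaleComparisonAtFace
import HarnessLib

/-!
# `HCCMUnconditional.HLiu418` from its residual named facts — the closing-file HEAD for item stmt-HodgeConjecture-24832
# (binder `hLiu418` → `HypLiu418`, [Liu 2021, Thm. 4.18] AS PRINTED at the conjugate space's transported datum)

Topic: summit `HodgeConjecture`, sub-problem `HodgeConjecture`, route `HCCMUnconditional`, crux `HLiu418` (= the pack decl
`PrintedCitationHypotheses.HypLiu418`, by `rfl`).  PROVER FILE (cell hodgecm-mathlib, D-0151 release track, ladder HODGECM-MATHLIB rung 0; seat A-p18 g2;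
pattern of A-p01's `HCCMUnconditionalH21OfFacts.lean` p606889 and B-p19's `HCCMUnconditionalHD3OfFacts.lean` p604835): sorry-free, axioms ⊆ trio,
THEOREMS ONLY, namespace `Summit.HodgeConjecture.CorCM.HypLiu418`.

It is A-plan2's registered line `Cruxes/HLiu418/Lines/a3_liu418.lean` (v6, md5 b3dbf6f37fa2; head `HLiu418_proof`) — whose crux workfile is NOT importable (it
carries the registered `sorry` slots) — with EVERY closed slot replaced BY NAME by its landed discharge and the FACT-LEVEL stubs left as explicit hypotheses, the
stub TYPES being the tree's face closures `A3Liu418FaceTypes.lean` (A-p18; byte-for-byte the crux's), so that every statement below is the crux's, character for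
character, and the closing one-liner of the item is
`HLiu418_proof h21 h413 hD3 := HLiu418_of_facts ‹III-0› ‹VI-1› ‹III-9′› ‹III-11› h21 h413 hD3` the day the four rows land:
* (I) `stub_albTransitionEpi` := A-p07's `stubAlbTransitionEpi_holds` (p599521, row VI-3 PROVED);
* (D) `stub_honestIsogenyDescent` := A-p12's `stubHonestIsogenyDescent_holds` (p604826, rows VI-4/VI-5/VI-6 PROVED);
* (1) `stub_levelInvariants_of` := A-p07's `levelInvariants_transport_of_epi_of_isogenyDescent` (p593390) — `levelInvariants_holds` below, UNCONDITIONAL;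
* (P, GAP 1) `stub_pinBettiPinning` := A-p18's `pinBettiPinning_of_lemma24 hL` (p603007; row III-0 = `hL`);
* (P at place) := A-p06's `bettiThetaModelAtPlace_of_hyp413_of_pinning h413 _` (p600917); (P off place) := A-p02's
  `stubBettiThetaModelOffPlace_of_h413_of_unique_of_lemma24 h413 canonicalModel_unique_printed_holds hL` (p607116) with row I-4 DISCHARGED by A-p07 g3's
  `UnitaryCanonicalModel.canonicalModel_unique_printed_holds` (p607432) — `bettiThetaModel_of_facts` below;
* `stub_etaleBettiModel_of` with row VI-2″ DISCHARGED at the face by A-p16's `stubEtaleComparisonAtFace_holds` (p608142, over `EtaleHeckeDatumOfTranslates` p607309,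
  `EtaleBettiComparisonHolds` p607861 and A-p18's `BettiComparisonOfPinning` p607148) — `etaleBettiModel_of_facts`; (F) := A-p17's `faltingsIsotypic_of_isInducedBy`
  (p603779; row VI-1 = `hFal`) —
  `faltingsIsotypic_of_faltings`; (S) := A-p18's `stubGaloisLabelSeparation_byName_of_casselman_of_thm415 h21 h415` (p599449; row III-9′ = `h415`);
  (G) := A-p19's `stub_mainGaloisGlue_of h21 hε` (p606438; row III-11 = `hε`); main + (3) := the crux's `stub_mainGalois_of` verbatim — `mainGalois_of_facts`;
* (N) := A-p08's `stubNonIso_of_hypD3_hypD1pp hD3 HD1pp_proof` (p593829 / B-p01 p603347); [Def 4.11] := B-p19's `H411_proof` (p603824).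

RESIDUAL HYPOTHESES of `HLiu418_of_facts` — EXACTLY the four FACT-LEVEL registered stubs of the line at its floor for tonight (director g2 batch 20, a3_liu418 v7:
III-0, VI-1, III-9′, III-11), each a named Literature fact or its ∀-closure over the face, plus the route items `H21`, `H413`, `HD3`:
`hL : Liu2021.albanese_bettiOne_pullback_bijective` ([Liu21 Lem. 2.4 (1)]; the one missing input of a `_holds` is Albanese base change [FGA VI 3.3 (iii)]),
`hFal : ∀ K A B ℓ, Motives.faltings_tate_bijective A B ℓ` ([Fal83 §5 Kor. 1]), `h415 : Thm415AtFace` (face closure of `Thm415Pinned`, [Liu21 Thm 4.15] = [MR92 Prop. 6]),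
`hε : EpsRigidAtFace` (face closure of `Thm418Data.EpsRigidUnderGaloisTwist`, [Liu21 Thm 4.18 (3) proof] + [BH06 41.2 (2)]).  Rows I-4 and VI-2″ are THEOREMS and enter
by name.  The AUDIT `example` at the end feeds the head into the route's deciding theorem `HCCMUnconditional.closes` with `H411_proof` ∕ `HD1pp_proof`: HC_CM ⇐ items
`HDel`, `H21`, `H413`, `HD3` + exactly these four residual types.  HC_CM is proved only modulo the 7 printed citations until rung 0 closes; this file discharges
none of them.

## References
* [Liu2021] Y. Liu, *Fourier–Jacobi cycles and arithmetic relative trace formula*, Camb. J. Math. 9 (2021) = arXiv:2102.11518: Thm. 4.18 (FJcycle.tex l. 2235–2243)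
  and its proof (l. 2245–2290); Prop. 4.13; Thm. 4.15; Lem. 2.4; App. D Lem. D.1.
* [Faltings1983Endlichkeit] §5 Satz 4, Kor. 1; [SGA4Tome3] Exp. XI Thm. 4.4; [Deligne1971TravauxShimura] 5.5; [MurtyRamakrishnan1992] Prop. 6;
  [BushnellHenniart2006] §41.2 (2); [Shimura1998] Thm. 21.4.
-/

set_option autoImplicit false

noncomputable section

namespace Summit.HodgeConjecture.CorCM.HypLiu418

open scoped TensorProduct Matrix
open NumberField NumberField.InfinitePlace
open HodgeCM.Model HodgeCM.Model.LiuIndex HodgeCM.Model.TowerCarrier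
open Summit.HodgeConjecture.CorCM.Model
open Literature.AlgebraicGeometry.Motives (CMType AbelianVariety)
open Literature.AlgebraicGeometry.HodgeTheory Literature.NumberTheory.Automorphic.PicardCM
open Literature.AlgebraicGeometry.ShimuraVarieties.UnitaryCanonicalModel
open Literature.NumberTheory.ComplexMultiplication
open Literature.NumberTheory.Automorphic
open Literature.NumberTheory.Automorphic.Liu2021 Literature.NumberTheory.Automorphic.Liu2021.AppendixC
open Literature.NumberTheory.Automorphic.Liu2021.AppendixC.RestOne
open Literature.RepresentationTheory Literature.RepresentationTheory.Liu2021
open Summit.HodgeConjecture.CorCM.Transposition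
open Summit.HodgeConjecture.CorCM.D2Bridge.MuKeyIdentLemD3DelRecConjOmegaEndT.PrintedCitationHypotheses (HypLiu418 Hyp411 Hyp413 HypD3 HypD1pp)
open Summit.HodgeConjecture.CorCM.Lines.A3Liu418
open Summit.HodgeConjecture.HodgeConjecture.Theses (HCCMUnconditional.HLiu418 HCCMUnconditional.H21 HCCMUnconditional.H413 HCCMUnconditional.HD3
  HCCMUnconditional.HDel)

/-! ## §1 Item (1): level invariants — UNCONDITIONAL ((I) + (D) are theorems) -/

set_option synthInstance.maxHeartbeats 400000 in
set_option maxHeartbeats 8000000 in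
/-- **Item (1) of [Liu2021, Thm. 4.18] at every face, UNCONDITIONALLY**: the crux's `stub_levelInvariants_of` fed with A-p07's `stubAlbTransitionEpi_holds` (row VI-3)
and A-p12's `stubHonestIsogenyDescent_holds` (rows VI-4/VI-5/VI-6), composed by `levelInvariants_transport_of_epi_of_isogenyDescent`.
[cite: Liu2021, Thm. 4.18 (1) (FJcycle.tex l. 2239) and proof (l. 2274–2282); Lem. 2.4 (1)] -/
theorem levelInvariants_holds : StubLevelInvariants := by
  intro hDel F _ h6 ι₁ V a Φ hΦ ν hν hw Φ'
  exact levelInvariants_transport_of_epi_of_isogenyDescent _ _ _ _ _ _ _ _ _ _ _ _ _ _ (stubAlbTransitionEpi_holds hDel F h6 V Φ)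
    (stubHonestIsogenyDescent_holds hDel F h6 V Φ)

/-! ## §2 [Prop. 4.13] pinned to the Albanese levels (P), and its étale form -/

set_option synthInstance.maxHeartbeats 400000 in
set_option maxHeartbeats 8000000 in
/-- **P from `H413` and row III-0** (row I-4 by A-p07's theorem `canonicalModel_unique_printed_holds`): the pinned Betti theta model at EVERY face — at place by
A-p06's `bettiThetaModelAtPlace_of_hyp413_of_pinning` over A-p18's GAP 1 `pinBettiPinning_of_lemma24 hL`, off place by A-p02's END
`stubBettiThetaModelOffPlace_of_h413_of_unique_of_lemma24 h413 canonicalModel_unique_printed_holds hL`, glued by the crux's case split `stub_bettiThetaModel_of`. [cite: Liu2021, Prop. 4.13 (FJcycle.tex l. 2110–2131); §4.2 l. 2074–2081; Lem. 2.4] [cite: Deligne1971TravauxShimura, 5.5] -/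
theorem bettiThetaModel_of_facts (h413 : Summit.HodgeConjecture.HodgeConjecture.Theses.HCCMUnconditional.H413)
    (hL : albanese_bettiOne_pullback_bijective) : StubBettiThetaModel := by
  intro hDel F _ h6 ι₁ V a Φ hΦ
  by_cases hemb : (NumberField.InfinitePlace.mk ι₁).embedding = ι₁
  · exact bettiThetaModelAtPlace_of_hyp413_of_pinning h413 (pinBettiPinning_of_lemma24 hL) hDel F h6 V hemb a Φ hΦ
  · exact stubBettiThetaModelOffPlace_of_h413_of_unique_of_lemma24 h413 canonicalModel_unique_printed_holds hL hDel F h6 V hemb a Φ hΦ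

set_option synthInstance.maxHeartbeats 400000 in
set_option maxHeartbeats 8000000 in
/-- **The étale Betti model from P and row VI-2″ (now a THEOREM)** — the crux's `stub_etaleBettiModel_of` with `hEt := stubEtaleComparisonAtFace_holds` (A-p16 p608142):
at `(ℓ, ι)`, take the pinned `(H, rhoB)`, apply the comparison theorem to its pinning, keep the induced `X`, the comparison and the decomposition.
[cite: Liu2021, §4.3 (FJcycle.tex l. 2152–2160); Prop. 4.13] [cite: SGA4Tome3, Exp. XI Thm. 4.4] -/
theorem etaleBettiModel_of_facts (hP : StubBettiThetaModel) : StubEtaleBettiModel := by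
  intro hDel F _ h6 ι₁ V a Φ hΦ ℓ _ ι'
  obtain ⟨τ', H, _, _, rhoB, ⟨B⟩, hdec⟩ := hP hDel F h6 V a Φ hΦ
  obtain ⟨X, cmp, _, hX, -⟩ := stubEtaleComparisonAtFace_holds hDel F h6 V Φ ℓ τ' ι' H rhoB B
  exact ⟨X, hX, H, _, _, rhoB, ⟨cmp⟩, hdec⟩

/-! ## §3 The ℓ-adic pieces (F), (S), (G) and MAIN + (3) -/

set_option synthInstance.maxHeartbeats 400000 in
set_option maxHeartbeats 8000000 in
/-- **(F) from row VI-1** — A-p17's `faltingsIsotypic_of_isInducedBy` (the crux's `stub_faltingsIsotypic` with Faltings as the hypothesis `hFal`).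
[cite: Liu2021, Thm. 4.18 proof (FJcycle.tex l. 2245–2263)] [cite: Faltings1983Endlichkeit, §5 Satz 4 and Korollar 1] -/
theorem faltingsIsotypic_of_faltings
    (hFal : ∀ {K : Type} [Field K] (A B : AbelianVariety K) (ℓ : ℕ) [Fact ℓ.Prime], Literature.AlgebraicGeometry.Motives.faltings_tate_bijective A B ℓ) :
    StubFaltingsIsotypic :=
  fun hDel F _ h6 ι₁ V _ Φ _ ν hν hw ℓ _ X ι' hX =>
    faltingsIsotypic_of_isInducedBy (CV hDel F V Φ) (AlgHom.id ℚ _) ι₁ hν hw (CarN F ι₁ ν hν) ℓ ι' (TV hDel F h6 V Φ) X hX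
      (fun _ _ => hFal _ _ ℓ)

set_option synthInstance.maxHeartbeats 400000 in
set_option maxHeartbeats 8000000 in
/-- **(S) from `H21` and row III-9′** — A-p18's `stubGaloisLabelSeparation_byName_of_casselman_of_thm415` (labels `μ′ ≠ ν` contribute nothing: [Thm 4.15] at `μ′` +
injectivity of `μ ↦ μ^{alg}`; `h21` makes `𝒜(μ′) ≠ ∅`). [cite: Liu2021, Thm. 4.15; Thm. 4.18 proof (FJcycle.tex l. 2258–2266)] -/
theorem galoisLabelSeparation_of_h21_of_thm415 (h21 : Summit.HodgeConjecture.HodgeConjecture.Theses.HCCMUnconditional.H21) (h415 : Thm415AtFace) :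
    StubGaloisLabelSeparation :=
  stubGaloisLabelSeparation_byName_of_casselman_of_thm415 h21 h415

set_option synthInstance.maxHeartbeats 400000 in
set_option maxHeartbeats 8000000 in
/-- **(G) from `H21` and row III-11** — A-p19's `stub_mainGaloisGlue_of` (the `ν^{alg}`-isotypic cut-out, item (3) and the transport `D₀ ↦ D′`).
[cite: Liu2021, Thm. 4.18 proof (FJcycle.tex l. 2245–2290)] [cite: BushnellHenniart2006, §41.2 (2)] -/
theorem mainGaloisGlue_of_h21_of_epsRigid (h21 : Summit.HodgeConjecture.HodgeConjecture.Theses.HCCMUnconditional.H21) (hε : EpsRigidAtFace) :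
    StubMainGaloisGlue :=
  stub_mainGaloisGlue_of h21 hε

set_option synthInstance.maxHeartbeats 400000 in
set_option maxHeartbeats 8000000 in
/-- **MAIN + (3)** from the five ℓ-adic pieces, [Thm 4.15], [Def 4.11] and item (2), pointwise in the face prefix — the crux's `stub_mainGalois_of` VERBATIM.
[cite: Liu2021, Thm. 4.18 proof (FJcycle.tex l. 2245–2272)] -/
theorem mainGalois_of_facts (hEB : StubEtaleBettiModel) (hF : StubFaltingsIsotypic) (hS : StubGaloisLabelSeparation)
    (hG : StubMainGaloisGlue) (h415 : Thm415AtFace) (h411 : Hyp411) (hN : StubNonIso) : StubMainGalois := by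
  intro hDel F _ h6 ι₁ V a Φ hΦ ν hν hw Φ' hSI
  refine hG h411 hDel F h6 V a Φ hΦ ν hν hw Φ' hSI ?_ (hN hDel F h6 V a Φ hΦ ν hν hw Φ')
  intro ℓ _ ι'
  obtain ⟨X, hX, hB⟩ := hEB hDel F h6 V a Φ hΦ ℓ ι'
  exact ⟨X, hX, hB, hF hDel F h6 V a Φ hΦ ν hν hw ℓ X ι' hX, fun obj => h415 hDel F h6 V a Φ hΦ ν hν hw ℓ X ι' obj hX,
    hS hDel F h6 V a Φ hΦ ν hν hw ℓ X ι' hX⟩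

set_option synthInstance.maxHeartbeats 400000 in
set_option maxHeartbeats 8000000 in
/-- **Item (2) from `HD3` and the CLOSED item `HD1pp`** — A-p08's `stubNonIso_of_hypD3_hypD1pp` with B-p01's `HD1pp_proof`.
[cite: Liu2021, Thm. 4.18 (2); App. D Lem. D.1 (1), (3)] -/
theorem nonIso_of_hD3 (hD3 : Summit.HodgeConjecture.HodgeConjecture.Theses.HCCMUnconditional.HD3) : StubNonIso :=
  stubNonIso_of_hypD3_hypD1pp hD3 Summit.HodgeConjecture.HodgeConjecture.Theorems.HD1pp_proof

/-! ## §4 The head: `HCCMUnconditional.HLiu418` modulo exactly the four fact-level residuals -/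

set_option synthInstance.maxHeartbeats 400000 in
set_option maxHeartbeats 8000000 in
/-- **CLOSING-FILE HEAD of item stmt-HodgeConjecture-24832 (route `HCCMUnconditional`, crux `HLiu418 := PrintedCitationHypotheses.HypLiu418`, by `rfl`), modulo
EXACTLY the line's four fact-level registered stubs left at tonight's floor** — `hL` (row III-0, [Liu21 Lem. 2.4 (1)]), `hFal` (row VI-1, [Fal83]), `h415` (row III-9′,
[Liu21 Thm 4.15] = [MR92 Prop. 6] at the face), `hε` (row III-11, ε-rigidity at the face) — and the route items `H21`, `H413`, `HD3`; rows I-4 (`canonicalModel_unique_printed_holds`,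
A-p07 g3 p607432) and VI-2″ (`stubEtaleComparisonAtFace_holds`, A-p16 p608142) enter as THEOREMS.  The composition is the crux head `HLiu418_proof` (v6) character for
character with every closed slot BY NAME (module docstring); the closing one-liner of the item is `HLiu418_proof h21 h413 hD3 := HLiu418_of_facts ‹III-0› ‹VI-1› ‹III-9′›
‹III-11› h21 h413 hD3` the day the four rows land.  HC_CM is proved only modulo the 7 printed citations until rung 0 closes. [cite: Liu2021, Thm. 4.18 (FJcycle.tex l. 2235–2290)] -/
theorem HLiu418_of_facts (hL : albanese_bettiOne_pullback_bijective)
    (hFal : ∀ {K : Type} [Field K] (A B : AbelianVariety K) (ℓ : ℕ) [Fact ℓ.Prime], Literature.AlgebraicGeometry.Motives.faltings_tate_bijective A B ℓ)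
    (h415 : Thm415AtFace) (hε : EpsRigidAtFace)
    (h21 : Summit.HodgeConjecture.HodgeConjecture.Theses.HCCMUnconditional.H21) (h413 : Summit.HodgeConjecture.HodgeConjecture.Theses.HCCMUnconditional.H413)
    (hD3 : Summit.HodgeConjecture.HodgeConjecture.Theses.HCCMUnconditional.HD3) :
    Summit.HodgeConjecture.HodgeConjecture.Theses.HCCMUnconditional.HLiu418 := by
  intro hDel F _ h6 ι₁ V a Φ hΦ ν hν hw R' hR' Φ'
  have hP : StubBettiThetaModel := bettiThetaModel_of_facts h413 hL
  have s2 : StubNonIso := nonIso_of_hD3 hD3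
  exact thm418AsPrinted_of_items _
    (mainGalois_of_facts (etaleBettiModel_of_facts hP) (faltingsIsotypic_of_faltings hFal) (galoisLabelSeparation_of_h21_of_thm415 h21 h415)
      (mainGaloisGlue_of_h21_of_epsRigid h21 hε) h415 Summit.HodgeConjecture.HodgeConjecture.Theorems.H411_proof s2 hDel F h6 V a Φ hΦ ν hν hw Φ' ⟨R', hR'⟩)
    (levelInvariants_holds hDel F h6 V a Φ hΦ ν hν hw Φ') (s2 hDel F h6 V a Φ hΦ ν hν hw Φ')

set_option synthInstance.maxHeartbeats 400000 in
set_option maxHeartbeats 8000000 in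
/-- AUDIT (kernel): fed into the route's deciding theorem `HCCMUnconditional.closes` together with the CLOSED items' theorems `H411_proof` ∕ `HD1pp_proof`, the head
leaves exactly the items `HDel`, `H21`, `H413`, `HD3` and the four fact-level residual TYPES as hypotheses of `CMAbelianHodge` (= HC_CM).  HC_CM is proved only modulo
the 7 printed citations until rung 0 closes. [cite: Liu2021, Thm. 4.18] -/
example (hL : albanese_bettiOne_pullback_bijective)
    (hFal : ∀ {K : Type} [Field K] (A B : AbelianVariety K) (ℓ : ℕ) [Fact ℓ.Prime], Literature.AlgebraicGeometry.Motives.faltings_tate_bijective A B ℓ)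
    (h415 : Thm415AtFace) (hε : EpsRigidAtFace)
    (hDel : Summit.HodgeConjecture.HodgeConjecture.Theses.HCCMUnconditional.HDel) (h21 : Summit.HodgeConjecture.HodgeConjecture.Theses.HCCMUnconditional.H21)
    (h413 : Summit.HodgeConjecture.HodgeConjecture.Theses.HCCMUnconditional.H413) (hD3 : Summit.HodgeConjecture.HodgeConjecture.Theses.HCCMUnconditional.HD3) :
    Summit.HodgeConjecture.HodgeConjecture.Theses.RankFourFaces.CMAbelianHodge :=
  Summit.HodgeConjecture.HodgeConjecture.Theses.HCCMUnconditional.closes hDel h21 (HLiu418_of_facts hL hFal h415 hε h21 h413 hD3) h413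
    Summit.HodgeConjecture.HodgeConjecture.Theorems.H411_proof hD3 Summit.HodgeConjecture.HodgeConjecture.Theorems.HD1pp_proof

end Summit.HodgeConjecture.CorCM.HypLiu418

end
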